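import Mathlib
import Summits.Ventures.PercRepro2.AS3Cases
import Summits.Ventures.PercRepro2.StepPattern

/-!
# The abstract pattern calculus: Reimer for every split, STEP(i,i+2) ⟺ BAL(i+1,i+1), the slack split
— for every event on subsets  (seat mine-b, cell pub-perc-repro2; conjectures/MINE-B.md §12)

`StepPattern.lean` proved, for the connection event of a finite multigraph, the pattern-level Reimer
inequality for every split `T(0, a+b) ≤ T(a, b)` and the equivalence STEP(i,i+2) ⟺ BAL(i+1,i+1).
Nothing in those proofs is graph-specific: here they are transcribed for the abstract pinned packing
counts `absT`, `absH` (AS3Cases.lean) of an ARBITRARY event `A` on subsets (a clutter with pins) —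
the framework of the row (REG-STEP) / (NOF7-STEP), whose objects are ports of binary matroids.
`absT_zero_add_le` needs no hypothesis on `A` at all (the pinned packing events are increasing
whatever `A` is).
-/

open Finset

namespace Summit.Ventures.PercRepro2

namespace StepZero

open ReimerCube

variable {E : Type*} [DecidableEq E]

/-- Trimming the pins: a disjoint occurrence of the packing events inside `O ∪ γ` is a disjoint
occurrence of the pinned packing events inside `γ`. -/
lemma dOcc_pinK_of_dOcc_union (A : Finset E → Prop) (O : Finset E) (a b : ℕ) {γ : Finset E}
    (h : DOcc (kDisj A a) (kDisj A b) (O ∪ γ)) :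
    DOcc (pinK A O a) (pinK A O b) γ := by
  obtain ⟨K, L, hK, hL, hKL, hA, hB⟩ := h
  refine ⟨K \ O, L \ O, ?_, ?_, ?_, ?_, ?_⟩
  · intro x hx
    rcases Finset.mem_union.mp (hK (Finset.mem_sdiff.mp hx).1) with h1 | h1
    · exact absurd h1 (Finset.mem_sdiff.mp hx).2
    · exact h1
  · intro x hx
    rcases Finset.mem_union.mp (hL (Finset.mem_sdiff.mp hx).1) with h1 | h1
    · exact absurd h1 (Finset.mem_sdiff.mp hx).2
    · exact h1
  · exact Finset.disjoint_of_subset_left Finset.sdiff_subset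
      (Finset.disjoint_of_subset_right Finset.sdiff_subset hKL)
  · intro T hT
    apply hA
    intro x hx
    by_cases hxO : x ∈ O
    · exact Finset.mem_union_left _ hxO
    · exact Finset.mem_union_right _ (hT (Finset.mem_sdiff.mpr ⟨hx, hxO⟩))
  · intro T hT
    apply hB
    intro x hx
    by_cases hxO : x ∈ O
    · exact Finset.mem_union_left _ hxO
    · exact Finset.mem_union_right _ (hT (Finset.mem_sdiff.mpr ⟨hx, hxO⟩))

open Classical in
/-- **Reimer on the abstract pattern for every split: `T(0, a+b) ≤ T(a, b)`** for every event `A`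
(`a = 1`: the `a = 1` rows of the BAL family, `T(0, b+1) ≤ T(1, b)`, for every clutter with pins). -/
theorem absT_zero_add_le (A : Finset E → Prop) (O Y : Finset E) (a b : ℕ) :
    absT A O Y 0 (a + b) ≤ absT A O Y a b := by
  rw [absT_swap A O Y a b]
  unfold absT
  have h := reimer_increasing Y (pinK A O a) (pinK A O b) (incr_pinK A O a) (incr_pinK A O b)
  refine le_trans (Finset.card_le_card ?_) (le_trans h (Finset.card_le_card ?_))
  · intro γ hγ
    rw [Finset.mem_filter] at hγ ⊢
    exact ⟨hγ.1, dOcc_pinK_of_dOcc_union A O a b (kDisj_add_dOcc _ a b hγ.2.2)⟩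
  · intro γ hγ
    rw [Finset.mem_filter] at hγ ⊢
    exact ⟨hγ.1, hγ.2.2, hγ.2.1⟩

/-- **STEP(i, i+2) ⟺ BAL(i+1, i+1)** on every abstract pattern: the diagonal STEP inequality is
the diagonal balance `T(i, i+2) ≤ T(i+1, i+1)`. -/
theorem absH_step_iff_bal (A : Finset E → Prop) (O Y : Finset E) (i : ℕ) :
    absH A O Y i (i + 2) ≤ absH A O Y (i + 1) (i + 1)
      ↔ absT A O Y i (i + 2) ≤ absT A O Y (i + 1) (i + 1) := by
  have h1 : absT A O Y i (i + 2) = absT A O Y (i + 1) (i + 2) + absH A O Y i (i + 2) :=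
    absT_eq_add_absH A O Y i (i + 2)
  have h2 : absT A O Y (i + 1) (i + 1) = absT A O Y (i + 2) (i + 1) + absH A O Y (i + 1) (i + 1) :=
    absT_eq_add_absH A O Y (i + 1) (i + 1)
  have h3 := absT_swap A O Y (i + 2) (i + 1)
  omega

/-- the Reimer slack `T(1,2) − T(0,3)` splits as the STEP(0,3) slack plus the BAL(2,2) slack, on every
abstract pattern -/
theorem absT_slack_split (A : Finset E → Prop) (O Y : Finset E) :
    absT A O Y 1 2 + absH A O Y 0 3 + absT A O Y 1 3
      = absT A O Y 0 3 + absH A O Y 1 2 + absT A O Y 2 2 := by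
  have h1 : absT A O Y 0 3 = absT A O Y 1 3 + absH A O Y 0 3 := absT_eq_add_absH A O Y 0 3
  have h2 : absT A O Y 1 2 = absT A O Y 2 2 + absH A O Y 1 2 := absT_eq_add_absH A O Y 1 2
  omega

end StepZero

end Summit.Ventures.PercRepro2
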